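import Summits.CriticalPhenomena.PercolationContinuityZ3.Theorems.PercNearOneGluingNoHeavyQuantOneBig
import HarnessLib

/-!
# QUANT lane R8, Conjecture DIB\* — CELL F1: the certificate `OneBigCert` HOLDS, part 1 (the five polynomial certificates and
# the reduced three-variable inequalities)

builds on p205010 (kernel theorem, internal audit signed; external expert review pending)

Support file (`--supports stmt-CriticalPhenomena-4575`), QUANT lane census-1 (gen 17); memo
`run/shared/lean/prim/quant/prim-quant-census-1/ONEBIG-G17.md`.  Theorems only, no definitions, no sorries, standard axioms.

THE OBJECT.  Lead g19's `Quant.IndepBlob.OneBigCert` (`…QuantOneBig`, p272761) is the closed-form real inequality to which CELL F1 of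
T-DIB ('exactly one blob of size `> j/2`') was reduced (`RootDec.oneBig_row_of_cert`).  Census (this seat, code/obc*.py; independently
postcont-1 g62 N-Q62): its normalised margin has infimum ZERO — corner `n = 1`, `b = j − 1`, `p = x`, all-heavy cloud at gate `x` with
`A = c/x`, `j(1−x) → ∞`, `x → 1`, where the margin is `(1−x)·3x(1−x)/(2(5−3x))` — but it is never negative.  So no lossy argument can
prove it; this file and `…QuantOneBigHolds` prove it EXACTLY.

THE REDUCTION (proved in `…QuantOneBigHolds`).  With `y = 1 − x`, `α = b/j`, `φ = φ_x(p)` the big's credit rate, `u = αφ`, `v = α(1 − φ)`,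
`c⋆ = 2j − bφ = j(2 − u)` (infimum of the cloud credit), monotonicity in `V` (up to `(j/2)(1−x)(2m − c⋆)`), in `A` (up to
`(m − (1−x)c⋆)/x²`) and in `m` (down to `c⋆`) bounds the menu items from below by closed forms in `(y, u, v)` alone:
Cantelli at level `ℓ = j − b` by `2(1+v)²/(y(2−u) + 2(1+v)²)`, Markov at level `j` by `x(1−u)/(2−x−u)` (if `u ≥ y`) or `x²` (if `u ≤ y`),
Cantelli at level `j` by `2(1−u)²/(y(2−u) + 2(1−u)²)`.  The pair (Cantelli_ℓ, Markov_j) is used for a heavy big and for a light big with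
`φ ≥ 3/5`; the pair (Cantelli_ℓ, Cantelli_j) for a light big with `φ ≤ 3/5`.

THIS FILE.
* `obcPoly_H1 … obcPoly_LB` — the five polynomial inequalities in `(y, u, v)` on their semialgebraic cells (heavy `uy ≥ xv` / light
  `xv ≥ uy`; `u ≥ y` / `u ≤ y`; `2u ≥ 3v` / `2u ≤ 3v`), each a HANDELMAN-type certificate (nonnegative combination of products of the cell's
  defining inequalities; degrees 4, 4, 6, 6, 6 with 26, 22, 49, 44, 46 products) found by LP (kit j132783: scipy/HiGHS, support re-solved and
  the identity verified in exact rational arithmetic) and replayed by `linarith`.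
* `obcCore_H1 … obcCore_LB` — the reduced inequalities `x ≤ p·T₁ + (1 − p)·T₀` with the closed-form items, derived from the polynomial
  ones by clearing the (positive) denominators.
[this work]; the gluing rows served [cite: KozmaNitzan2024, Conjecture 3 (p. 15)]; product weights [cite: Grimmett1999, §1.3 p. 10].
-/

namespace Summit.CriticalPhenomena.PercolationContinuityZ3.Theorems

namespace Quant

namespace IndepBlob

/-! ### 1. The five polynomial certificates (`y = 1 − x`, `u = αφ`, `v = α(1 − φ)`) -/

/-- Polynomial certificate, heavy big, `u ≥ y` (pair Cantelli/Markov, Markov at `m = c⋆`): degree 4, 26 products (kit j132783; exact identity verified in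
rational arithmetic; replayed by `linarith`).  Coordinates `y = 1 − x`, `u = αφ`, `v = α(1 − φ)`. [this work] -/
theorem obcPoly_H1 (y u v : ℝ) (hy : 0 ≤ y) (hhy : 0 ≤ 1 / 2 - y) (hu : 0 ≤ u) (hv : 0 ≤ v) (hal1 : 0 ≤ 1 - u - v) (halh : 0 ≤ u + v - 1 / 2)
    (hhv : 0 ≤ u * y - (1 - y) * v) (huy : 0 ≤ u - y) :
    0 ≤ u * (1 + y - u) * (y * (2 - u) + 2 * (1 + v) ^ 2) - (1 - y) * v * (y * (2 - u) + 2 * (1 + v) ^ 2)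
      - u * (2 - u) * (1 + y - u) := by
  linarith [
    mul_nonneg hy hy, mul_nonneg (mul_nonneg hy hy) hy, mul_nonneg (mul_nonneg hy hy) hv, mul_nonneg (mul_nonneg hy hy) halh,
    mul_nonneg (mul_nonneg hy hhy) hhv, mul_nonneg (mul_nonneg hy hv) hhv, mul_nonneg (mul_nonneg (mul_nonneg hy hal1) hal1) huy, mul_nonneg hy hhv,
    mul_nonneg (mul_nonneg (mul_nonneg hu hu) hal1) hal1, mul_nonneg (mul_nonneg hu hv) hv, mul_nonneg (mul_nonneg (mul_nonneg hu hv) hv) hv,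
    mul_nonneg (mul_nonneg (mul_nonneg hu hv) hal1) halh, mul_nonneg hu hal1, mul_nonneg (mul_nonneg hu hhv) huy,
    mul_nonneg (mul_nonneg (mul_nonneg hv hv) hv) huy, mul_nonneg (mul_nonneg (mul_nonneg hv hv) hal1) huy, mul_nonneg (mul_nonneg hv hv) hhv,
    mul_nonneg (mul_nonneg hv hv) huy, mul_nonneg (mul_nonneg hv hal1) hhv, mul_nonneg (mul_nonneg hv hal1) huy, mul_nonneg hv hhv,
    mul_nonneg hal1 halh, mul_nonneg (mul_nonneg hal1 halh) halh, mul_nonneg hal1 hhv, mul_nonneg (mul_nonneg (mul_nonneg hal1 huy) huy) huy]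

/-- Polynomial certificate, heavy big, `u ≤ y` (pair Cantelli/Markov, Markov at `∞`): degree 4, 22 products (kit j132783; exact identity verified in
rational arithmetic; replayed by `linarith`).  Coordinates `y = 1 − x`, `u = αφ`, `v = α(1 − φ)`. [this work] -/
theorem obcPoly_H2 (y u v : ℝ) (hy : 0 ≤ y) (hhy : 0 ≤ 1 / 2 - y) (hu : 0 ≤ u) (hv : 0 ≤ v) (hal1 : 0 ≤ 1 - u - v) (halh : 0 ≤ u + v - 1 / 2)
    (hhv : 0 ≤ u * y - (1 - y) * v) (hyu : 0 ≤ y - u) :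
    0 ≤ (y * (2 - u) + 2 * (1 + v) ^ 2) * (u - (1 - y) * v) - u * (2 - u) := by
  linarith [
    mul_nonneg (mul_nonneg hy hy) hhy, mul_nonneg hy hhy, mul_nonneg (mul_nonneg (mul_nonneg hhy hhy) hhy) hv, mul_nonneg (mul_nonneg hhy hu) hv,
    mul_nonneg (mul_nonneg (mul_nonneg hhy hu) hv) hv, mul_nonneg (mul_nonneg hhy hu) hyu, mul_nonneg hhy halh, mul_nonneg (mul_nonneg hu hu) hu,
    mul_nonneg (mul_nonneg (mul_nonneg hu hu) hu) hv, mul_nonneg (mul_nonneg hu hv) hv, mul_nonneg hu halh, mul_nonneg (mul_nonneg hv hv) hhv,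
    mul_nonneg (mul_nonneg hv hal1) hhv, mul_nonneg hv hhv, mul_nonneg (mul_nonneg (mul_nonneg hv hyu) hyu) hyu, mul_nonneg hal1 hhv,
    mul_nonneg hhv hyu, mul_nonneg (mul_nonneg hyu hyu) hyu]

/-- Polynomial certificate, light big with `φ ≥ 3/5`, `u ≥ y` (pair Cantelli/Markov): degree 6, 49 products (kit j132783; exact identity verified in
rational arithmetic; replayed by `linarith`).  Coordinates `y = 1 − x`, `u = αφ`, `v = α(1 − φ)`. [this work] -/
theorem obcPoly_L1 (y u v : ℝ) (hy : 0 ≤ y) (hhy : 0 ≤ 1 / 2 - y) (hu : 0 ≤ u) (hv : 0 ≤ v) (hal1 : 0 ≤ 1 - u - v) (halh : 0 ≤ u + v - 1 / 2)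
    (hlt : 0 ≤ (1 - y) * v - u * y) (huy : 0 ≤ u - y) (hsp : 0 ≤ 2 * u - 3 * v) :
    0 ≤ ((u * y - (1 - y) * v) * (1 + y - u) + ((u + v) * (2 - y) - u) * (1 - y) * (1 - u)) * (y * (2 - u) + 2 * (1 + v) ^ 2)
      - ((u + v) * (1 - y) ^ 2 + y * u) * (2 - u) * (1 + y - u) := by
  linarith [
    mul_nonneg (mul_nonneg hy hy) hy, mul_nonneg (mul_nonneg (mul_nonneg (mul_nonneg (mul_nonneg hy hy) hy) halh) hsp) hsp,
    mul_nonneg (mul_nonneg (mul_nonneg (mul_nonneg hy hy) hy) hsp) hsp,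
    mul_nonneg (mul_nonneg (mul_nonneg (mul_nonneg (mul_nonneg hy hy) hhy) hal1) hal1) hal1, mul_nonneg (mul_nonneg hy hy) hu,
    mul_nonneg (mul_nonneg (mul_nonneg hy hy) hal1) hsp, mul_nonneg (mul_nonneg hy hy) halh, mul_nonneg (mul_nonneg (mul_nonneg hy hy) hlt) hsp,
    mul_nonneg (mul_nonneg (mul_nonneg hy hv) hv) hsp, mul_nonneg (mul_nonneg (mul_nonneg hy hv) hlt) hsp, mul_nonneg (mul_nonneg hy hv) hsp,
    mul_nonneg (mul_nonneg (mul_nonneg (mul_nonneg hy hv) hsp) hsp) hsp, mul_nonneg (mul_nonneg (mul_nonneg (mul_nonneg hy hal1) hal1) hsp) hsp,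
    mul_nonneg (mul_nonneg hy hal1) hsp, mul_nonneg (mul_nonneg (mul_nonneg (mul_nonneg hy hlt) huy) hsp) hsp, mul_nonneg (mul_nonneg hy hlt) hsp,
    mul_nonneg (mul_nonneg (mul_nonneg (mul_nonneg hy hlt) hsp) hsp) hsp,
    mul_nonneg (mul_nonneg (mul_nonneg (mul_nonneg (mul_nonneg hhy hhy) hhy) hal1) hal1) hal1,
    mul_nonneg (mul_nonneg (mul_nonneg (mul_nonneg (mul_nonneg hhy hhy) hal1) hal1) halh) hsp,
    mul_nonneg (mul_nonneg (mul_nonneg (mul_nonneg hhy hhy) hal1) hlt) hsp,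
    mul_nonneg (mul_nonneg (mul_nonneg (mul_nonneg (mul_nonneg hhy hhy) hal1) hsp) hsp) hsp,
    mul_nonneg (mul_nonneg (mul_nonneg (mul_nonneg hhy hal1) hal1) halh) hsp,
    mul_nonneg (mul_nonneg (mul_nonneg (mul_nonneg hhy hal1) hal1) hlt) hsp, mul_nonneg (mul_nonneg (mul_nonneg hhy hal1) halh) hlt,
    mul_nonneg (mul_nonneg (mul_nonneg (mul_nonneg hhy hal1) hsp) hsp) hsp, mul_nonneg hhy hlt, mul_nonneg (mul_nonneg (mul_nonneg hhy hlt) hsp) hsp,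
    mul_nonneg hu hal1, mul_nonneg (mul_nonneg (mul_nonneg hu hal1) hal1) hsp, mul_nonneg hv hv, mul_nonneg (mul_nonneg hv hal1) huy,
    mul_nonneg (mul_nonneg hv hal1) hsp, mul_nonneg (mul_nonneg (mul_nonneg hal1 hal1) halh) hsp,
    mul_nonneg (mul_nonneg (mul_nonneg hal1 hal1) hsp) hsp, mul_nonneg hal1 halh, mul_nonneg (mul_nonneg hal1 halh) halh,
    mul_nonneg (mul_nonneg (mul_nonneg hal1 halh) halh) halh, mul_nonneg (mul_nonneg hal1 halh) hlt,
    mul_nonneg (mul_nonneg (mul_nonneg hal1 halh) hlt) hlt, mul_nonneg (mul_nonneg (mul_nonneg hal1 halh) hlt) huy,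
    mul_nonneg (mul_nonneg hal1 halh) huy, mul_nonneg (mul_nonneg hal1 hlt) huy, mul_nonneg hal1 huy,
    mul_nonneg (mul_nonneg (mul_nonneg hal1 huy) huy) huy, mul_nonneg (mul_nonneg (mul_nonneg hal1 hsp) hsp) hsp, mul_nonneg hlt hlt,
    mul_nonneg (mul_nonneg hlt hlt) hlt, mul_nonneg (mul_nonneg (mul_nonneg hlt hlt) hsp) hsp, mul_nonneg (mul_nonneg (mul_nonneg hlt huy) hsp) hsp]

/-- Polynomial certificate, light big with `φ ≥ 3/5`, `u ≤ y`: degree 6, 44 products (kit j132783; exact identity verified in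
rational arithmetic; replayed by `linarith`).  Coordinates `y = 1 − x`, `u = αφ`, `v = α(1 − φ)`. [this work] -/
theorem obcPoly_L2 (y u v : ℝ) (hy : 0 ≤ y) (hhy : 0 ≤ 1 / 2 - y) (hu : 0 ≤ u) (hv : 0 ≤ v) (hal1 : 0 ≤ 1 - u - v) (halh : 0 ≤ u + v - 1 / 2)
    (hlt : 0 ≤ (1 - y) * v - u * y) (hyu : 0 ≤ y - u) (hsp : 0 ≤ 2 * u - 3 * v) :
    0 ≤ ((u * y - (1 - y) * v) + ((u + v) * (2 - y) - u) * (1 - y) ^ 2) * (y * (2 - u) + 2 * (1 + v) ^ 2)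
      - ((u + v) * (1 - y) ^ 2 + y * u) * (2 - u) := by
  linarith [
    mul_nonneg (mul_nonneg hy hy) hy, mul_nonneg (mul_nonneg (mul_nonneg (mul_nonneg (mul_nonneg hy hy) hhy) hal1) hal1) hal1,
    mul_nonneg (mul_nonneg (mul_nonneg (mul_nonneg hy hy) hhy) hlt) hsp, mul_nonneg (mul_nonneg (mul_nonneg (mul_nonneg hy hy) halh) hsp) hsp,
    mul_nonneg (mul_nonneg (mul_nonneg hy hy) hsp) hsp, mul_nonneg (mul_nonneg hy hhy) hhy,
    mul_nonneg (mul_nonneg (mul_nonneg (mul_nonneg hy hhy) hhy) hal1) hlt, mul_nonneg (mul_nonneg (mul_nonneg hy hhy) hhy) hlt,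
    mul_nonneg (mul_nonneg (mul_nonneg (mul_nonneg hy hal1) hal1) hsp) hsp, mul_nonneg (mul_nonneg (mul_nonneg hy hlt) hlt) hsp,
    mul_nonneg (mul_nonneg hy hlt) hsp, mul_nonneg (mul_nonneg (mul_nonneg (mul_nonneg (mul_nonneg hhy hhy) hhy) hal1) hal1) hal1,
    mul_nonneg (mul_nonneg (mul_nonneg (mul_nonneg hhy hhy) halh) hsp) hsp, mul_nonneg (mul_nonneg (mul_nonneg (mul_nonneg hhy hhy) hlt) hsp) hsp,
    mul_nonneg (mul_nonneg (mul_nonneg (mul_nonneg hhy hal1) hal1) hlt) hsp, mul_nonneg (mul_nonneg (mul_nonneg (mul_nonneg hhy hal1) halh) hsp) hsp,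
    mul_nonneg hhy hlt, mul_nonneg (mul_nonneg hhy hlt) hlt, mul_nonneg (mul_nonneg (mul_nonneg hhy hlt) hyu) hsp,
    mul_nonneg (mul_nonneg (mul_nonneg hhy hlt) hsp) hsp, mul_nonneg hu hlt, mul_nonneg hv hsp, mul_nonneg (mul_nonneg hal1 hal1) hal1,
    mul_nonneg (mul_nonneg hal1 halh) hsp, mul_nonneg halh halh, mul_nonneg (mul_nonneg halh halh) hlt, mul_nonneg (mul_nonneg halh hlt) hlt,
    mul_nonneg (mul_nonneg (mul_nonneg halh hlt) hyu) hsp, mul_nonneg (mul_nonneg halh hyu) hyu,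
    mul_nonneg (mul_nonneg (mul_nonneg halh hsp) hsp) hsp, mul_nonneg hlt hlt, mul_nonneg (mul_nonneg hlt hlt) hlt,
    mul_nonneg (mul_nonneg (mul_nonneg hlt hlt) hyu) hsp, mul_nonneg (mul_nonneg (mul_nonneg hlt hlt) hsp) hsp, mul_nonneg (mul_nonneg hlt hyu) hsp,
    mul_nonneg hlt hsp, mul_nonneg hyu hyu, mul_nonneg hyu hsp, mul_nonneg (mul_nonneg hyu hsp) hsp, mul_nonneg (mul_nonneg hsp hsp) hsp]

/-- Polynomial certificate, light big with `φ ≤ 3/5` (pair Cantelli/Cantelli): degree 6, 46 products (kit j132783; exact identity verified in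
rational arithmetic; replayed by `linarith`).  Coordinates `y = 1 − x`, `u = αφ`, `v = α(1 − φ)`. [this work] -/
theorem obcPoly_LB (y u v : ℝ) (hy : 0 ≤ y) (hhy : 0 ≤ 1 / 2 - y) (hu : 0 ≤ u) (_hv : 0 ≤ v) (hal1 : 0 ≤ 1 - u - v) (halh : 0 ≤ u + v - 1 / 2)
    (hlt : 0 ≤ (1 - y) * v - u * y) (hsp : 0 ≤ 3 * v - 2 * u) :
    0 ≤ (u * y - (1 - y) * v) * (y * (2 - u) + 2 * (1 + v) ^ 2) * (y * (2 - u) + 2 * (1 - u) ^ 2)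
      + ((u + v) * (2 - y) - u) * (2 * (1 - u) ^ 2) * (y * (2 - u) + 2 * (1 + v) ^ 2)
      - ((u + v) * (1 - y) ^ 2 + y * u) * (2 - u) * (y * (2 - u) + 2 * (1 - u) ^ 2) := by
  linarith [
    mul_nonneg hy hy, mul_nonneg (mul_nonneg hy hy) halh, mul_nonneg (mul_nonneg (mul_nonneg hy hy) halh) hsp,
    mul_nonneg (mul_nonneg (mul_nonneg (mul_nonneg hy hy) halh) hsp) hsp, mul_nonneg (mul_nonneg hy hy) hsp,
    mul_nonneg (mul_nonneg (mul_nonneg hy hy) hsp) hsp, mul_nonneg (mul_nonneg (mul_nonneg hy hhy) hal1) hal1,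
    mul_nonneg (mul_nonneg (mul_nonneg hy hal1) hal1) halh, mul_nonneg (mul_nonneg (mul_nonneg hy hal1) halh) hsp,
    mul_nonneg (mul_nonneg (mul_nonneg (mul_nonneg hy hal1) halh) hsp) hsp, mul_nonneg (mul_nonneg (mul_nonneg hy halh) hsp) hsp,
    mul_nonneg (mul_nonneg (mul_nonneg (mul_nonneg hy halh) hsp) hsp) hsp, mul_nonneg hy hsp, mul_nonneg (mul_nonneg hy hsp) hsp,
    mul_nonneg (mul_nonneg (mul_nonneg hy hsp) hsp) hsp, mul_nonneg (mul_nonneg (mul_nonneg (mul_nonneg (mul_nonneg hhy hhy) hal1) hal1) hal1) hal1,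
    mul_nonneg (mul_nonneg (mul_nonneg (mul_nonneg (mul_nonneg hhy hhy) hal1) halh) halh) hsp,
    mul_nonneg (mul_nonneg (mul_nonneg hhy hal1) hal1) hal1, mul_nonneg (mul_nonneg (mul_nonneg (mul_nonneg hhy hal1) hal1) hal1) hal1,
    mul_nonneg (mul_nonneg (mul_nonneg (mul_nonneg hhy hal1) hal1) hal1) hsp, mul_nonneg (mul_nonneg (mul_nonneg hhy hal1) halh) hlt,
    mul_nonneg (mul_nonneg (mul_nonneg (mul_nonneg hhy halh) hlt) hsp) hsp, mul_nonneg hhy hlt, mul_nonneg (mul_nonneg hhy hlt) hsp,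
    mul_nonneg hu hal1, mul_nonneg (mul_nonneg (mul_nonneg (mul_nonneg hal1 hal1) hal1) hal1) hsp,
    mul_nonneg (mul_nonneg (mul_nonneg hal1 hal1) halh) halh, mul_nonneg hal1 halh, mul_nonneg (mul_nonneg (mul_nonneg hal1 halh) halh) hlt,
    mul_nonneg (mul_nonneg (mul_nonneg hal1 halh) halh) hsp, mul_nonneg (mul_nonneg (mul_nonneg (mul_nonneg hal1 halh) halh) hsp) hsp,
    mul_nonneg (mul_nonneg hal1 halh) hsp, mul_nonneg (mul_nonneg (mul_nonneg hal1 halh) hsp) hsp,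
    mul_nonneg (mul_nonneg (mul_nonneg (mul_nonneg hal1 halh) hsp) hsp) hsp,
    mul_nonneg (mul_nonneg (mul_nonneg (mul_nonneg halh halh) halh) halh) halh, mul_nonneg (mul_nonneg halh hsp) hsp,
    mul_nonneg (mul_nonneg (mul_nonneg halh hsp) hsp) hsp, mul_nonneg (mul_nonneg (mul_nonneg (mul_nonneg halh hsp) hsp) hsp) hsp,
    mul_nonneg hlt hlt, mul_nonneg (mul_nonneg hlt hlt) hsp, mul_nonneg (mul_nonneg (mul_nonneg hlt hlt) hsp) hsp, mul_nonneg hsp hsp,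
    mul_nonneg (mul_nonneg hsp hsp) hsp]

/-! ### 2. The reduced inequalities `x ≤ p·T₁ + (1 − p)·T₀` -/

/-- Positivity of the Cantelli-ℓ denominator `(1−x)(2−u) + 2(1+v)²`. [this work] -/
theorem obc_D_pos (x u v : ℝ) (hx1 : x < 1) (hu1 : u ≤ 1) : 0 < (1 - x) * (2 - u) + 2 * (1 + v) ^ 2 := by
  nlinarith [mul_nonneg (sub_nonneg.2 hx1.le) (by linarith : (0:ℝ) ≤ 2 - u)]

/-- Positivity of the Cantelli-j denominator `(1−x)(2−u) + 2(1−u)²` (for `x < 1`, `u ≤ 1`). [this work] -/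
theorem obc_Dp_pos (x u : ℝ) (hx1 : x < 1) (hu1 : u ≤ 1) : 0 < (1 - x) * (2 - u) + 2 * (1 - u) ^ 2 := by
  nlinarith [mul_pos (sub_pos.2 hx1) (by linarith : (0:ℝ) < 2 - u), sq_nonneg (1 - u)]

/-- **Reduced inequality, heavy big, `u ≥ 1 − x`** (`p(u+v) = u`): `x ≤ p·2(1+v)²/D + (1−p)·x(1−u)/(2−x−u)`. [this work] -/
theorem obcCore_H1 (x u v p : ℝ) (hx : 1 / 2 ≤ x) (hx1 : x < 1) (hu : 0 ≤ u) (hv : 0 ≤ v) (hal1 : u + v ≤ 1)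
    (halh : 1 / 2 ≤ u + v) (hp : p * (u + v) = u) (hhv : x * v ≤ u * (1 - x)) (huy : 1 - x ≤ u) :
    x ≤ p * (2 * (1 + v) ^ 2 / ((1 - x) * (2 - u) + 2 * (1 + v) ^ 2)) + (1 - p) * (x * (1 - u) / (2 - x - u)) := by
  have hα : 0 < u + v := by linarith
  have hD := obc_D_pos x u v hx1 (by linarith)
  have hE : 0 < 2 - x - u := by linarith
  have hF := obcPoly_H1 (1 - x) u v (by linarith) (by linarith) hu hv (by linarith) (by linarith) (by nlinarith) (by linarith)
  have hq : (1 - p) * (u + v) = v := by linarith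
  have key : x * (u + v) ≤ u * (2 * (1 + v) ^ 2 / ((1 - x) * (2 - u) + 2 * (1 + v) ^ 2)) + v * (x * (1 - u) / (2 - x - u)) := by
    have e : u * (2 * (1 + v) ^ 2 / ((1 - x) * (2 - u) + 2 * (1 + v) ^ 2)) + v * (x * (1 - u) / (2 - x - u)) - x * (u + v) =
        (1 - x) * (u * (1 + (1 - x) - u) * ((1 - x) * (2 - u) + 2 * (1 + v) ^ 2)
          - (1 - (1 - x)) * v * ((1 - x) * (2 - u) + 2 * (1 + v) ^ 2) - u * (2 - u) * (1 + (1 - x) - u)) /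
        (((1 - x) * (2 - u) + 2 * (1 + v) ^ 2) * (2 - x - u)) := by
      field_simp
      ring
    have h0 : 0 ≤ (1 - x) * (u * (1 + (1 - x) - u) * ((1 - x) * (2 - u) + 2 * (1 + v) ^ 2)
          - (1 - (1 - x)) * v * ((1 - x) * (2 - u) + 2 * (1 + v) ^ 2) - u * (2 - u) * (1 + (1 - x) - u)) /
        (((1 - x) * (2 - u) + 2 * (1 + v) ^ 2) * (2 - x - u)) :=
      div_nonneg (mul_nonneg (by linarith) hF) (mul_pos hD hE).le
    linarith
  have e2 : p * (2 * (1 + v) ^ 2 / ((1 - x) * (2 - u) + 2 * (1 + v) ^ 2)) + (1 - p) * (x * (1 - u) / (2 - x - u)) =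
      (u * (2 * (1 + v) ^ 2 / ((1 - x) * (2 - u) + 2 * (1 + v) ^ 2)) + v * (x * (1 - u) / (2 - x - u))) / (u + v) := by
    rw [eq_div_iff hα.ne', add_mul, mul_assoc, mul_comm _ (u + v), ← mul_assoc, hp, mul_assoc (1 - p), mul_comm _ (u + v),
      ← mul_assoc, hq]
  rw [e2, le_div_iff₀ hα]
  exact key

/-- **Reduced inequality, heavy big, `u ≤ 1 − x`** (`p(u+v) = u`): `x ≤ p·2(1+v)²/D + (1−p)·x²`. [this work] -/
theorem obcCore_H2 (x u v p : ℝ) (hx : 1 / 2 ≤ x) (hx1 : x < 1) (hu : 0 ≤ u) (hv : 0 ≤ v) (hal1 : u + v ≤ 1)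
    (halh : 1 / 2 ≤ u + v) (hp : p * (u + v) = u) (hhv : x * v ≤ u * (1 - x)) (hyu : u ≤ 1 - x) :
    x ≤ p * (2 * (1 + v) ^ 2 / ((1 - x) * (2 - u) + 2 * (1 + v) ^ 2)) + (1 - p) * x ^ 2 := by
  have hα : 0 < u + v := by linarith
  have hD := obc_D_pos x u v hx1 (by linarith)
  have hF := obcPoly_H2 (1 - x) u v (by linarith) (by linarith) hu hv (by linarith) (by linarith) (by nlinarith) (by linarith)
  have hq : (1 - p) * (u + v) = v := by linarith
  have key : x * (u + v) ≤ u * (2 * (1 + v) ^ 2 / ((1 - x) * (2 - u) + 2 * (1 + v) ^ 2)) + v * x ^ 2 := by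
    have e : u * (2 * (1 + v) ^ 2 / ((1 - x) * (2 - u) + 2 * (1 + v) ^ 2)) + v * x ^ 2 - x * (u + v) =
        (1 - x) * (((1 - x) * (2 - u) + 2 * (1 + v) ^ 2) * (u - (1 - (1 - x)) * v) - u * (2 - u)) /
        ((1 - x) * (2 - u) + 2 * (1 + v) ^ 2) := by
      field_simp
      ring
    have h0 : 0 ≤ (1 - x) * (((1 - x) * (2 - u) + 2 * (1 + v) ^ 2) * (u - (1 - (1 - x)) * v) - u * (2 - u)) /
        ((1 - x) * (2 - u) + 2 * (1 + v) ^ 2) := div_nonneg (mul_nonneg (by linarith) hF) hD.le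
    linarith
  have e2 : p * (2 * (1 + v) ^ 2 / ((1 - x) * (2 - u) + 2 * (1 + v) ^ 2)) + (1 - p) * x ^ 2 =
      (u * (2 * (1 + v) ^ 2 / ((1 - x) * (2 - u) + 2 * (1 + v) ^ 2)) + v * x ^ 2) / (u + v) := by
    rw [eq_div_iff hα.ne', add_mul, mul_assoc, mul_comm _ (u + v), ← mul_assoc, hp, mul_assoc (1 - p), mul_comm _ (u + v),
      ← mul_assoc, hq]
  rw [e2, le_div_iff₀ hα]
  exact key

/-- **Reduced inequality, light big with `φ ≥ 3/5`, `u ≥ 1 − x`** (`p(u+v) = (u+v)x² + (1−x)u`, i.e. `p = x² + (1−x)φ`):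
`x ≤ p·2(1+v)²/D + (1−p)·x(1−u)/(2−x−u)`. [this work] -/
theorem obcCore_L1 (x u v p : ℝ) (hx : 1 / 2 ≤ x) (hx1 : x < 1) (hu : 0 ≤ u) (hv : 0 ≤ v) (hal1 : u + v ≤ 1)
    (halh : 1 / 2 ≤ u + v) (hp : p * (u + v) = (u + v) * x ^ 2 + (1 - x) * u) (hlt : u * (1 - x) ≤ x * v) (huy : 1 - x ≤ u)
    (hsp : 3 * v ≤ 2 * u) :
    x ≤ p * (2 * (1 + v) ^ 2 / ((1 - x) * (2 - u) + 2 * (1 + v) ^ 2)) + (1 - p) * (x * (1 - u) / (2 - x - u)) := by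
  have hα : 0 < u + v := by linarith
  have hD := obc_D_pos x u v hx1 (by linarith)
  have hE : 0 < 2 - x - u := by linarith
  have hF := obcPoly_L1 (1 - x) u v (by linarith) (by linarith) hu hv (by linarith) (by linarith) (by nlinarith) (by linarith)
    (by linarith)
  have hq : (1 - p) * (u + v) = (1 - x) * ((u + v) * (2 - (1 - x)) - u) := by linear_combination (-1 : ℝ) * hp
  have key : x * (u + v) ≤ ((u + v) * x ^ 2 + (1 - x) * u) * (2 * (1 + v) ^ 2 / ((1 - x) * (2 - u) + 2 * (1 + v) ^ 2)) +
      (1 - x) * ((u + v) * (2 - (1 - x)) - u) * (x * (1 - u) / (2 - x - u)) := by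
    have e : ((u + v) * x ^ 2 + (1 - x) * u) * (2 * (1 + v) ^ 2 / ((1 - x) * (2 - u) + 2 * (1 + v) ^ 2)) +
        (1 - x) * ((u + v) * (2 - (1 - x)) - u) * (x * (1 - u) / (2 - x - u)) - x * (u + v) =
        (1 - x) * (((u * (1 - x) - (1 - (1 - x)) * v) * (1 + (1 - x) - u) + ((u + v) * (2 - (1 - x)) - u) * (1 - (1 - x)) * (1 - u))
            * ((1 - x) * (2 - u) + 2 * (1 + v) ^ 2)
          - ((u + v) * (1 - (1 - x)) ^ 2 + (1 - x) * u) * (2 - u) * (1 + (1 - x) - u)) /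
        (((1 - x) * (2 - u) + 2 * (1 + v) ^ 2) * (2 - x - u)) := by
      field_simp
      ring
    have h0 : 0 ≤ (1 - x) * (((u * (1 - x) - (1 - (1 - x)) * v) * (1 + (1 - x) - u) +
            ((u + v) * (2 - (1 - x)) - u) * (1 - (1 - x)) * (1 - u)) * ((1 - x) * (2 - u) + 2 * (1 + v) ^ 2)
          - ((u + v) * (1 - (1 - x)) ^ 2 + (1 - x) * u) * (2 - u) * (1 + (1 - x) - u)) /
        (((1 - x) * (2 - u) + 2 * (1 + v) ^ 2) * (2 - x - u)) :=
      div_nonneg (mul_nonneg (by linarith) hF) (mul_pos hD hE).le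
    linarith
  have e2 : p * (2 * (1 + v) ^ 2 / ((1 - x) * (2 - u) + 2 * (1 + v) ^ 2)) + (1 - p) * (x * (1 - u) / (2 - x - u)) =
      (((u + v) * x ^ 2 + (1 - x) * u) * (2 * (1 + v) ^ 2 / ((1 - x) * (2 - u) + 2 * (1 + v) ^ 2)) +
      (1 - x) * ((u + v) * (2 - (1 - x)) - u) * (x * (1 - u) / (2 - x - u))) / (u + v) := by
    rw [eq_div_iff hα.ne', add_mul, mul_assoc p, mul_comm _ (u + v), ← mul_assoc, hp, mul_assoc (1 - p), mul_comm _ (u + v),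
      ← mul_assoc (1 - p), hq]
  rw [e2, le_div_iff₀ hα]
  exact key

/-- **Reduced inequality, light big with `φ ≥ 3/5`, `u ≤ 1 − x`**: `x ≤ p·2(1+v)²/D + (1−p)·x²`. [this work] -/
theorem obcCore_L2 (x u v p : ℝ) (hx : 1 / 2 ≤ x) (hx1 : x < 1) (hu : 0 ≤ u) (hv : 0 ≤ v) (hal1 : u + v ≤ 1)
    (halh : 1 / 2 ≤ u + v) (hp : p * (u + v) = (u + v) * x ^ 2 + (1 - x) * u) (hlt : u * (1 - x) ≤ x * v) (hyu : u ≤ 1 - x)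
    (hsp : 3 * v ≤ 2 * u) :
    x ≤ p * (2 * (1 + v) ^ 2 / ((1 - x) * (2 - u) + 2 * (1 + v) ^ 2)) + (1 - p) * x ^ 2 := by
  have hα : 0 < u + v := by linarith
  have hD := obc_D_pos x u v hx1 (by linarith)
  have hF := obcPoly_L2 (1 - x) u v (by linarith) (by linarith) hu hv (by linarith) (by linarith) (by nlinarith) (by linarith)
    (by linarith)
  have hq : (1 - p) * (u + v) = (1 - x) * ((u + v) * (2 - (1 - x)) - u) := by linear_combination (-1 : ℝ) * hp
  have key : x * (u + v) ≤ ((u + v) * x ^ 2 + (1 - x) * u) * (2 * (1 + v) ^ 2 / ((1 - x) * (2 - u) + 2 * (1 + v) ^ 2)) +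
      (1 - x) * ((u + v) * (2 - (1 - x)) - u) * x ^ 2 := by
    have e : ((u + v) * x ^ 2 + (1 - x) * u) * (2 * (1 + v) ^ 2 / ((1 - x) * (2 - u) + 2 * (1 + v) ^ 2)) +
        (1 - x) * ((u + v) * (2 - (1 - x)) - u) * x ^ 2 - x * (u + v) =
        (1 - x) * (((u * (1 - x) - (1 - (1 - x)) * v) + ((u + v) * (2 - (1 - x)) - u) * (1 - (1 - x)) ^ 2)
            * ((1 - x) * (2 - u) + 2 * (1 + v) ^ 2)
          - ((u + v) * (1 - (1 - x)) ^ 2 + (1 - x) * u) * (2 - u)) /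
        ((1 - x) * (2 - u) + 2 * (1 + v) ^ 2) := by
      field_simp
      ring
    have h0 : 0 ≤ (1 - x) * (((u * (1 - x) - (1 - (1 - x)) * v) + ((u + v) * (2 - (1 - x)) - u) * (1 - (1 - x)) ^ 2)
            * ((1 - x) * (2 - u) + 2 * (1 + v) ^ 2)
          - ((u + v) * (1 - (1 - x)) ^ 2 + (1 - x) * u) * (2 - u)) /
        ((1 - x) * (2 - u) + 2 * (1 + v) ^ 2) := div_nonneg (mul_nonneg (by linarith) hF) hD.le
    linarith
  have e2 : p * (2 * (1 + v) ^ 2 / ((1 - x) * (2 - u) + 2 * (1 + v) ^ 2)) + (1 - p) * x ^ 2 =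
      (((u + v) * x ^ 2 + (1 - x) * u) * (2 * (1 + v) ^ 2 / ((1 - x) * (2 - u) + 2 * (1 + v) ^ 2)) +
      (1 - x) * ((u + v) * (2 - (1 - x)) - u) * x ^ 2) / (u + v) := by
    rw [eq_div_iff hα.ne', add_mul, mul_assoc p, mul_comm _ (u + v), ← mul_assoc, hp, mul_assoc (1 - p), mul_comm _ (u + v),
      ← mul_assoc (1 - p), hq]
  rw [e2, le_div_iff₀ hα]
  exact key

/-- **Reduced inequality, light big with `φ ≤ 3/5`**: `x ≤ p·2(1+v)²/D + (1−p)·2(1−u)²/((1−x)(2−u) + 2(1−u)²)`. [this work] -/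
theorem obcCore_LB (x u v p : ℝ) (hx : 1 / 2 ≤ x) (hx1 : x < 1) (hu : 0 ≤ u) (hv : 0 ≤ v) (hal1 : u + v ≤ 1)
    (halh : 1 / 2 ≤ u + v) (hp : p * (u + v) = (u + v) * x ^ 2 + (1 - x) * u) (hlt : u * (1 - x) ≤ x * v)
    (hsp : 2 * u ≤ 3 * v) :
    x ≤ p * (2 * (1 + v) ^ 2 / ((1 - x) * (2 - u) + 2 * (1 + v) ^ 2)) +
      (1 - p) * (2 * (1 - u) ^ 2 / ((1 - x) * (2 - u) + 2 * (1 - u) ^ 2)) := by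
  have hα : 0 < u + v := by linarith
  have hD := obc_D_pos x u v hx1 (by linarith)
  have hDp := obc_Dp_pos x u hx1 (by linarith)
  have hF := obcPoly_LB (1 - x) u v (by linarith) (by linarith) hu hv (by linarith) (by linarith) (by nlinarith) (by linarith)
  have hq : (1 - p) * (u + v) = (1 - x) * ((u + v) * (2 - (1 - x)) - u) := by linear_combination (-1 : ℝ) * hp
  have key : x * (u + v) ≤ ((u + v) * x ^ 2 + (1 - x) * u) * (2 * (1 + v) ^ 2 / ((1 - x) * (2 - u) + 2 * (1 + v) ^ 2)) +
      (1 - x) * ((u + v) * (2 - (1 - x)) - u) * (2 * (1 - u) ^ 2 / ((1 - x) * (2 - u) + 2 * (1 - u) ^ 2)) := by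
    have e : ((u + v) * x ^ 2 + (1 - x) * u) * (2 * (1 + v) ^ 2 / ((1 - x) * (2 - u) + 2 * (1 + v) ^ 2)) +
        (1 - x) * ((u + v) * (2 - (1 - x)) - u) * (2 * (1 - u) ^ 2 / ((1 - x) * (2 - u) + 2 * (1 - u) ^ 2)) - x * (u + v) =
        (1 - x) * ((u * (1 - x) - (1 - (1 - x)) * v) * ((1 - x) * (2 - u) + 2 * (1 + v) ^ 2) * ((1 - x) * (2 - u) + 2 * (1 - u) ^ 2)
          + ((u + v) * (2 - (1 - x)) - u) * (2 * (1 - u) ^ 2) * ((1 - x) * (2 - u) + 2 * (1 + v) ^ 2)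
          - ((u + v) * (1 - (1 - x)) ^ 2 + (1 - x) * u) * (2 - u) * ((1 - x) * (2 - u) + 2 * (1 - u) ^ 2)) /
        (((1 - x) * (2 - u) + 2 * (1 + v) ^ 2) * ((1 - x) * (2 - u) + 2 * (1 - u) ^ 2)) := by
      field_simp
      ring
    have h0 : 0 ≤ (1 - x) * ((u * (1 - x) - (1 - (1 - x)) * v) * ((1 - x) * (2 - u) + 2 * (1 + v) ^ 2) *
            ((1 - x) * (2 - u) + 2 * (1 - u) ^ 2)
          + ((u + v) * (2 - (1 - x)) - u) * (2 * (1 - u) ^ 2) * ((1 - x) * (2 - u) + 2 * (1 + v) ^ 2)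
          - ((u + v) * (1 - (1 - x)) ^ 2 + (1 - x) * u) * (2 - u) * ((1 - x) * (2 - u) + 2 * (1 - u) ^ 2)) /
        (((1 - x) * (2 - u) + 2 * (1 + v) ^ 2) * ((1 - x) * (2 - u) + 2 * (1 - u) ^ 2)) :=
      div_nonneg (mul_nonneg (by linarith) hF) (mul_pos hD hDp).le
    linarith
  have e2 : p * (2 * (1 + v) ^ 2 / ((1 - x) * (2 - u) + 2 * (1 + v) ^ 2)) +
      (1 - p) * (2 * (1 - u) ^ 2 / ((1 - x) * (2 - u) + 2 * (1 - u) ^ 2)) =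
      (((u + v) * x ^ 2 + (1 - x) * u) * (2 * (1 + v) ^ 2 / ((1 - x) * (2 - u) + 2 * (1 + v) ^ 2)) +
      (1 - x) * ((u + v) * (2 - (1 - x)) - u) * (2 * (1 - u) ^ 2 / ((1 - x) * (2 - u) + 2 * (1 - u) ^ 2))) / (u + v) := by
    rw [eq_div_iff hα.ne', add_mul, mul_assoc p, mul_comm _ (u + v), ← mul_assoc, hp, mul_assoc (1 - p), mul_comm _ (u + v),
      ← mul_assoc (1 - p), hq]
  rw [e2, le_div_iff₀ hα]
  exact key

end IndepBlob

end Quant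

end Summit.CriticalPhenomena.PercolationContinuityZ3.Theorems
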